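import Summits.BirchSwinnertonDyer.BirchSwinnertonDyer.Theorems.KimAtThreeFineKatoKPortLimitLog
import Summits.BirchSwinnertonDyer.BirchSwinnertonDyer.Theorems.KimAtThreeFineKatoKPortJunctionUnit
import Literature.NumberTheory.EllipticCurves.PadicLogFiniteExtensionEquivProofs
import Literature.NumberTheory.GaloisRepresentations.PadicAlgebraOfLocalField
import Literature.NumberTheory.Automorphic.AdicCompletionLocalField
import HarnessLib

/-!
# K-PORT junction (J4c): the log-currency junction AT `K := K_w` — kport's log-lattice
# `Λ₀ʷ = {Λ̃ P : P ∈ E₀(K_w)}` consists of values of the Literature logarithm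
# `padicLogPointFiniteExt ν (W.baseChange L_w) p` of the cite facts (S5b)/(S5b-res), for EVERY compatible `ν`;
# the model identity `curveK p (Kw p L w) W_ℤ = W.baseChange L_w`; the `ℚ_[p]`-algebra / trace identity (J3′)
# (cell `bsd-addord`, seat w2-kport gen 3; `--supports stmt-BirchSwinnertonDyer-19560`, helper)

HONEST FRAMING. Route W2 (`route-BirchSwinnertonDyer-KimAtThreeKolyvagin`), crux 19560
`KatoKuriharaPortThreeShared`, registered line `perFactorKato` (stub hKloc, kim3 LEAD). Clause (d) of the
displayed hypothesis hLog/hLog₀ is `KPort.clause_d_unit_package` (w2-kport gen 2): its log-lattice at the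
factor `w ∣ p` of `L = ℚ(ζ_m)` is the SET `Λ₀ʷ := {Kw.toCompletion (Λ̃ P) : P ∈ E₀(K_w)} ⊆ L_w`, `Λ̃ = KPort.satLog`
on the points of kport's model `curveK p (Kw p L w) W_ℤ` (`W_ℤ = integralModelInt W ⊗ ℤ_p`). Clause (e)
(owner w2-acc4, via the cite fact (S5b)/(S5b-res) `PAdicHodge.exists_smul_range_expStarCoord_iff_trace_log`)
is stated at `F = L_w = w.1.adicCompletion L` with the Literature logarithm
`FormalGroupChart.padicLogPointFiniteExt ν (W.baseChange F) p` for a valuation `ν : Valuation F ℝ≥0` with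
`[ν.Compatible]`, the trace `Algebra.trace ℚ_[p] F` of the `ℚ_[p]`-algebra structure
`LocalField.adicCompletionPadicAlgebra`, and the points of Mathlib's model `W.baseChange F`. THIS FILE closes
the three gaps between the two currencies:

* §1 **`Kw.curveK_integralModelInt_eq_baseChange`**: `curveK p (Kw p L w) W_ℤ = W.baseChange (w.1.adicCompletion L)`
  (both are `W_ℤ` mapped along the unique ring map `ℤ → L_w`; `map_integralModelInt`);
  `baseChange_completion_baseChange`: `(W ⊗ ℚ_v) ⊗ L_w = W ⊗ L_w` (w2-c3's tower recipe model);
  `exists_point_padicLogPointFiniteExt_eq_of_eq` (transport of `log_ω` along an equality of models);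
  `isIntegral_baseChange_completion` (`W ⊗ L_w` is `ν`-integral for EVERY valuation `ν`, `W` globally minimal).
* §2 valuations on `L_w`: `Kw.prime_mem_asIdeal` (`p ∈ w`), **`Kw.valuation_isEquiv_valued`** (the base-`p`
  norm valuation of `K_w` is equivalent to `Valued.v`), **`Kw.valuation_isEquiv_of_compatible`** (… and to every
  `ν` compatible with the valuative relation of `L_w`, `ValuativeRel.isEquiv`).
* §3 (J3′) **`Kw.algebraMap_adicCompletionPadicAlgebra_eq`**: the canonical `ℚ_[p]`-structure of the local field
  `L_w` (`LocalField.adicCompletionPadicAlgebra`, unique continuous `ℚ_[p] → L_w`) IS kport's `(ℚ_v → L_w) ∘ e_p`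
  (`Kw.instAlgebraPadic`; continuity of `e_p = Padic.adicCompletionEquiv` and of the packet map);
  **`Kw.trace_adicCompletionPadicAlgebra_eq`**: `Tr_{L_w/ℚ_[p]} = e_p⁻¹ ∘ Tr_{L_w/ℚ_v}` for that structure
  (the trace of clause (e) / (S5b) versus the `e₃⁻¹ Tr_{L_w/ℚ_v}` of hLog).
* §4 **`Kw.exists_point_padicLogPointFiniteExt_eq_satLog`**: for every compatible `ν` and every point `P` of
  kport's model there is a point `P′` of `W.baseChange L_w` with `log_ω^{ν}(P′) = Kw.toCompletion (Λ̃ P)`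
  ((J4a) `satLog_eq_padicLogPointFiniteExt` + (J4b) `padicLogPointFiniteExt_eq_of_isEquiv` + §1);
  **`Kw.clause_d_set_subset_range_padicLogPointFiniteExt`**: `Λ₀ʷ ⊆ {log_ω^{ν}(P′) : P′ ∈ E(L_w)}` — so a
  statement "`∀ P′ : (W.baseChange L_w).Point, Φ(log_ω P′)`" (the shape of (S5b-res)'s conclusion / DUALINT_w)
  yields "`∀ ℓ ∈ Λ₀ʷ, Φ ℓ`" (`Kw.forall_clause_d_set_of_forall_point`), which is clause (e) for kport's `Λ₀ʷ`.

TOOL theorems only (no definition, no named fact, no `sorry`, no instance); closes nothing by itself;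
nothing booked; BSD / 19560 are not proved by any of this ((S5b-res), DUALINT_w, the wild-level ι-push and the
Galois-side tower transport are other seats' — w2-acc4 g5 / w2-c3 g8).

References: J. H. Silverman, *The Arithmetic of Elliptic Curves*, 2nd ed. (2009), IV.6.4, VII.2
[SilvermanAEC2009]; J.-P. Serre, *Local Fields* (1979), Ch. II §1–§3 [SerreLocalFields1979];
J. W. S. Cassels, A. Fröhlich, *Algebraic Number Theory* (1967), Ch. II §10 [CasselsFrohlichANT1967].
-/

noncomputable section

-- the cell's Theorems namespace `Summit.BirchSwinnertonDyer.BirchSwinnertonDyer.…` repeats the summit name by design (D-0017)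
set_option linter.dupNamespace false

open scoped NNReal NumberField Classical
open IsDedekindDomain NumberField

namespace Summit.BirchSwinnertonDyer.BirchSwinnertonDyer.Theorems.KPort

open Summit.BirchSwinnertonDyer.Rank1Residual.Additive Summit.BirchSwinnertonDyer.Rank1Residual.Additive.BallEval
open Summit.BirchSwinnertonDyer.Rank1Residual.Additive.LocalLog Literature.NumberTheory.EllipticCurves.Rank1Residual
open Literature.NumberTheory.GaloisRepresentations.LubinTate (unitBall mem_unitBall_iff)
open Literature.NumberTheory.EllipticCurves Literature.NumberTheory.EllipticCurves.FormalGroupChart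
open Literature.NumberTheory.GaloisRepresentations
open WeierstrassCurve

namespace Kw

variable {p : ℕ} [hp : Fact p.Prime] {L : Type} [Field L] [NumberField L]
  (w : ((Rat.HeightOneSpectrum.primesEquiv (R := 𝓞 ℚ)).symm ⟨p, hp.out⟩).Extension (𝓞 L))

/-! ## §1 Models: `curveK p K_w W_ℤ = W ⊗ L_w`; transport of `log_ω` along an equality of models -/

/-- **kport's model is Mathlib's base change**: `curveK p (Kw p L w) (W_ℤ ⊗ ℤ_p) = W.baseChange L_w` for `W/ℚ`
globally minimal with integral model `W_ℤ = integralModelInt W` — both are `W_ℤ` mapped along the unique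
ring homomorphism `ℤ → L_w` (`map_integralModelInt`: `W_ℤ ⊗ ℚ = W`). [folklore] -/
theorem curveK_integralModelInt_eq_baseChange [Fact (w.1.asIdeal.ramificationIdx (𝓞 ℚ) = 1)]
    (W : WeierstrassCurve ℚ) [W.IsGloballyMinimal] :
    curveK p (Kw p L w) ((integralModelInt W).map (Int.castRingHom ℤ_[p])) = W.baseChange (w.1.adicCompletion L) := by
  have hW := map_integralModelInt W
  unfold curveK
  rw [WeierstrassCurve.map_map]
  conv_rhs => rw [← hW, WeierstrassCurve.baseChange, WeierstrassCurve.map_map]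
  congr 1
  exact Subsingleton.elim _ _

/-- The tower model equals the direct one: `(W ⊗ ℚ_v) ⊗ L_w = W ⊗ L_w` (both are `W` mapped along the unique
ring homomorphism `ℚ → L_w`). [folklore] -/
theorem baseChange_completion_baseChange (W : WeierstrassCurve ℚ) :
    (W.baseChange (((Rat.HeightOneSpectrum.primesEquiv (R := 𝓞 ℚ)).symm ⟨p, hp.out⟩).adicCompletion ℚ)).baseChange
        (w.1.adicCompletion L) = W.baseChange (w.1.adicCompletion L) := by
  rw [WeierstrassCurve.baseChange, WeierstrassCurve.baseChange, WeierstrassCurve.baseChange, WeierstrassCurve.map_map]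
  congr 1
  exact Subsingleton.elim _ _

/-- **Transport of `log_ω` along an equality of models**: for `h : V = V'` over the same field, every point
`P` of `V` is a point `P'` of `V'` with the same logarithm (`subst`; no arithmetic). [folklore] -/
theorem exists_point_padicLogPointFiniteExt_eq_of_eq {F : Type*} [Field F] (ν : Valuation F ℝ≥0)
    {V V' : WeierstrassCurve F} (h : V = V') [V.IsIntegral ν.integer] [V'.IsIntegral ν.integer] (q : ℕ)
    (P : V.toAffine.Point) :
    ∃ P' : V'.toAffine.Point, padicLogPointFiniteExt ν V' q P' = padicLogPointFiniteExt ν V q P := by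
  subst h
  exact ⟨P, rfl⟩

/-- `|n| ≤ 1` for every integer `n` and every valuation. [folklore] -/
theorem val_intCast_le_one {F : Type*} [Field F] (ν : Valuation F ℝ≥0) (a : ℤ) : ν (a : F) ≤ 1 := by
  obtain ⟨n, rfl | rfl⟩ := Int.eq_nat_or_neg a
  · rw [Int.cast_natCast]; exact FormalGroupChart.val_natCast_le_one ν n
  · rw [Int.cast_neg, Int.cast_natCast, Valuation.map_neg]; exact FormalGroupChart.val_natCast_le_one ν n

/-- **`W ⊗ F` is `ν`-integral for EVERY valuation `ν` of `F`** when `W/ℚ` is globally minimal (its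
coefficients are integers): the integrality hypothesis of (S5b) at `F = L_w`, for any choice of `ν`.
[cite: SilvermanAEC2009, VII.1 (Weierstrass equations with coefficients in R, PDF p. 165)] -/
theorem isIntegral_baseChange_of_isGloballyMinimal {F : Type*} [Field F] [Algebra ℚ F] (ν : Valuation F ℝ≥0)
    (W : WeierstrassCurve ℚ) [W.IsGloballyMinimal] : (W.baseChange F).IsIntegral ν.integer := by
  have hW := map_integralModelInt W
  have hc : ∀ a : ℤ, algebraMap ℚ F (Int.castRingHom ℚ a) = (a : F) := fun a => by simp
  refine isIntegral_integer_of_val_le_one ?_ ?_ ?_ ?_ ?_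
  · rw [baseChange, map_a₁, ← hW, map_a₁, hc]; exact val_intCast_le_one ν _
  · rw [baseChange, map_a₂, ← hW, map_a₂, hc]; exact val_intCast_le_one ν _
  · rw [baseChange, map_a₃, ← hW, map_a₃, hc]; exact val_intCast_le_one ν _
  · rw [baseChange, map_a₄, ← hW, map_a₄, hc]; exact val_intCast_le_one ν _
  · rw [baseChange, map_a₆, ← hW, map_a₆, hc]; exact val_intCast_le_one ν _

/-- `W ⊗ L_w` is `ν`-integral for every valuation `ν` of `L_w`. [cite: SilvermanAEC2009, VII.1 (Weierstrass equations with coefficients in R, PDF p. 165)] -/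
theorem isIntegral_baseChange_completion (ν : Valuation (w.1.adicCompletion L) ℝ≥0) (W : WeierstrassCurve ℚ)
    [W.IsGloballyMinimal] : (W.baseChange (w.1.adicCompletion L)).IsIntegral ν.integer :=
  isIntegral_baseChange_of_isGloballyMinimal ν W

/-! ## §2 Valuations on `L_w`: the base-`p` norm of `K_w`, `Valued.v`, and any compatible `ν` are equivalent -/

/-- **`p ∈ w`** for a place `w` of `L` above `v_p = primesEquiv.symm p` (`w.under 𝓞_ℚ = v_p ∋ p`): keys the
`ℚ_[p]`-algebra / `|p|_w < 1` structures `LocalField.adicCompletionPadicAlgebra w.1 p _`. [folklore] -/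
theorem prime_mem_asIdeal : ((p : ℕ) : 𝓞 L) ∈ w.1.asIdeal := by
  have h0 : ((p : ℕ) : 𝓞 ℚ) ∈ ((Rat.HeightOneSpectrum.primesEquiv (R := 𝓞 ℚ)).symm ⟨p, hp.out⟩).asIdeal :=
    (natCast_mem_asIdeal_iff_eq_primesEquiv_symm _ hp.out).mpr rfl
  have h1 := w.2
  rw [HeightOneSpectrum.ext_iff] at h1
  rw [← h1] at h0
  change ((p : ℕ) : 𝓞 ℚ) ∈ Ideal.comap (algebraMap (𝓞 ℚ) (𝓞 L)) w.1.asIdeal at h0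
  rw [Ideal.mem_comap, map_natCast] at h0
  exact h0

/-- **The base-`p` norm valuation `‖·‖₊` of `K_w` is equivalent to the `w`-adic valuation `Valued.v`**
(same unit ball, (J1) `Kw.norm_le_one_iff`). [cite: SerreLocalFields1979, Ch. II §1] -/
theorem valuation_isEquiv_valued :
    (NormedField.valuation : Valuation (Kw p L w) ℝ≥0).IsEquiv
      (Valued.v : Valuation (Kw p L w) (WithZero (Multiplicative ℤ))) := by
  rw [Valuation.isEquiv_iff_val_le_one]
  intro x
  rw [NormedField.valuation_apply, ← NNReal.coe_le_coe, coe_nnnorm, NNReal.coe_one]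
  exact norm_le_one_iff x

/-- **The base-`p` norm valuation of `K_w` is equivalent to every `ℝ≥0`-valued valuation `ν` of `L_w`
compatible with its valuative relation** (the `[ν.Compatible]` binder of (S5b); e.g. Mathlib's base-`N(w)`
norm valuation), read on `K_w` along the identity `Kw.toCompletion` (`ν.comap`): both are equivalent to
`Valued.v` (`ValuativeRel.isEquiv`). [cite: SerreLocalFields1979, Ch. II §1] -/
theorem valuation_isEquiv_of_compatible (ν : Valuation (w.1.adicCompletion L) ℝ≥0) [ν.Compatible] :
    (NormedField.valuation : Valuation (Kw p L w) ℝ≥0).IsEquiv (ν.comap (toCompletion p L w).toRingHom) := by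
  have h1 := valuation_isEquiv_valued (p := p) (L := L) (w := w)
  have h2 : (ν.comap (toCompletion p L w).toRingHom).IsEquiv
      (Valued.v : Valuation (Kw p L w) (WithZero (Multiplicative ℤ))) := by
    rw [Valuation.isEquiv_iff_val_le_one]
    intro x
    rw [Valuation.comap_apply, ← valued_toCompletion x]
    exact (ValuativeRel.isEquiv ν (Valued.v : Valuation (w.1.adicCompletion L) (WithZero (Multiplicative ℤ)))).le_one_iff_le_one
  exact h1.trans h2.symm

/-- `ν.comap Kw.toCompletion` evaluates as `ν` (the identity map). [folklore] -/
@[simp] theorem comap_toCompletion_apply (ν : Valuation (w.1.adicCompletion L) ℝ≥0) (x : Kw p L w) :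
    ν.comap (toCompletion p L w).toRingHom x = ν (toCompletion p L w x) := rfl

/-! ## §3 (J3′) The canonical `ℚ_[p]`-structure of the local field `L_w` is kport's; traces -/

/-- kport's `algebraMap ℚ_[p] K_w = (ℚ_v → L_w) ∘ e_p` is continuous (`e_p = Padic.adicCompletionEquiv` is a
homeomorphism, the packet map `ℚ_v → L_w` is continuous). [folklore] -/
theorem continuous_algebraMap_padic : Continuous (algebraMap ℚ_[p] (Kw p L w)) := by
  have h1 : Continuous (Padic.adicCompletionEquiv (𝓞 ℚ) ⟨p, hp.out⟩) :=
    (Padic.adicCompletionEquiv (𝓞 ℚ) ⟨p, hp.out⟩).continuous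
  have h2 : Continuous (algebraMap (((Rat.HeightOneSpectrum.primesEquiv (R := 𝓞 ℚ)).symm ⟨p, hp.out⟩).adicCompletion ℚ)
      (w.1.adicCompletion L)) :=
    w.adicCompletionSemialgHom_continuous ℚ L
  exact h2.comp h1

/-- **(J3′, maps) The canonical `ℚ_[p]`-algebra structure of the local field `L_w`
(`LocalField.adicCompletionPadicAlgebra w.1 p _`: the unique continuous `ℚ_[p] → L_w`) IS kport's structure on
`K_w`** (`algebraMap = (ℚ_v → L_w) ∘ e_p`, continuous). [cite: SerreLocalFields1979, Ch. II §3] -/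
theorem algebraMap_adicCompletionPadicAlgebra_eq (hw : ((p : ℕ) : 𝓞 L) ∈ w.1.asIdeal) (r : ℚ_[p]) :
    (letI := LocalField.adicCompletionPadicAlgebra w.1 p hw; algebraMap ℚ_[p] (w.1.adicCompletion L) r) =
      toCompletion p L w (algebraMap ℚ_[p] (Kw p L w) r) := by
  have hcont : Continuous ((toCompletion p L w).toRingHom.comp (algebraMap ℚ_[p] (Kw p L w))) :=
    continuous_algebraMap_padic w
  have h := LocalField.eq_algebraMap_adicCompletionPadicAlgebra w.1 p hw _ hcont
  exact (RingHom.congr_fun h r).symm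

/-- **(J3′, traces) `Tr_{L_w/ℚ_[p]} = e_p⁻¹ ∘ Tr_{L_w/ℚ_v}` for the canonical `ℚ_[p]`-structure of `L_w`**
— the trace in which (S5b)/(S5b-res) and DUALINT_w are written equals the `e₃⁻¹ Tr_{L_w/ℚ_v}` of hLog's
clauses (d)/(e) ((J3) `Kw.trace_eq` moved along `algebraMap_adicCompletionPadicAlgebra_eq`).
[cite: CasselsFrohlichANT1967, Ch. II §10] -/
theorem trace_adicCompletionPadicAlgebra_eq (hw : ((p : ℕ) : 𝓞 L) ∈ w.1.asIdeal) (x : w.1.adicCompletion L) :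
    (letI := LocalField.adicCompletionPadicAlgebra w.1 p hw; Algebra.trace ℚ_[p] (w.1.adicCompletion L) x) =
      (Padic.adicCompletionEquiv (𝓞 ℚ) ⟨p, hp.out⟩).symm
        (Algebra.trace (((Rat.HeightOneSpectrum.primesEquiv (R := 𝓞 ℚ)).symm ⟨p, hp.out⟩).adicCompletion ℚ)
          (w.1.adicCompletion L) x) := by
  letI := LocalField.adicCompletionPadicAlgebra w.1 p hw
  let e : Kw p L w ≃ₐ[ℚ_[p]] w.1.adicCompletion L :=
    AlgEquiv.ofRingEquiv (f := toCompletion p L w) fun r => (algebraMap_adicCompletionPadicAlgebra_eq w hw r).symm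
  have h := Algebra.trace_eq_of_algEquiv e ((toCompletion p L w).symm x)
  have he : e ((toCompletion p L w).symm x) = x := rfl
  rw [he] at h
  rw [h, trace_eq]
  rfl

/-! ## §4 The log-currency junction at `K_w`: `Λ₀ʷ ⊆ log_ω(E(L_w))` for every compatible `ν` -/

section Log

variable [he : Fact (w.1.asIdeal.ramificationIdx (𝓞 ℚ) = 1)] (W : WeierstrassCurve ℚ) [W.IsGloballyMinimal]
  [hE : (((integralModelInt W).map (Int.castRingHom ℤ_[p])).map PadicInt.Coe.ringHom).IsElliptic]
  [hint : (curveK p (Kw p L w) ((integralModelInt W).map (Int.castRingHom ℤ_[p]))).IsIntegral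
    (NormedField.valuation (K := Kw p L w)).integer]
  (ν : Valuation (w.1.adicCompletion L) ℝ≥0) [ν.Compatible]
  [hν : (W.baseChange (w.1.adicCompletion L)).IsIntegral ν.integer]

omit he [ν.Compatible] in
/-- A `ν`-integral equation over `L_w` is integral for `ν` read on `K_w` (`ν.comap Kw.toCompletion`; same
coefficients, same values). [folklore] -/
theorem isIntegral_comap_toCompletion (V : WeierstrassCurve (w.1.adicCompletion L)) [hV : V.IsIntegral ν.integer] :
    @WeierstrassCurve.IsIntegral (ν.comap (toCompletion p L w).toRingHom).integer _ (Kw p L w) _ _ V :=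
  isIntegral_integer_of_val_le_one (val_a₁_le_one (w := ν) (V := V)) (val_a₂_le_one (w := ν) (V := V))
    (val_a₃_le_one (w := ν) (V := V)) (val_a₄_le_one (w := ν) (V := V)) (val_a₆_le_one (w := ν) (V := V))

omit he [ν.Compatible] in
/-- Reading `log_ω` on `K_w`: the logarithm of a point of an equation over `L_w` for `ν` is the logarithm of
the same point for `ν.comap Kw.toCompletion` over the synonym `K_w` (definitionally). [folklore] -/
theorem padicLogPointFiniteExt_comap_toCompletion (V : WeierstrassCurve (w.1.adicCompletion L))
    [hV : V.IsIntegral ν.integer] (q : ℕ) (P : V.toAffine.Point) :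
    @padicLogPointFiniteExt (Kw p L w) (Kw.instField p L w) (ν.comap (toCompletion p L w).toRingHom) V q
        (isIntegral_comap_toCompletion (p := p) w ν V) P = padicLogPointFiniteExt ν V q P :=
  rfl

/-- **Every value of kport's logarithm is a value of the Literature logarithm on `W ⊗ L_w`**: for every point
`P` of kport's model `curveK p (Kw p L w) W_ℤ` there is a point `P′` of `W.baseChange L_w` (the same point read
through §1) with `padicLogPointFiniteExt ν (W.baseChange L_w) p P′ = Kw.toCompletion (Λ̃ P)`, for EVERY `ν`
compatible with the valuative relation of `L_w` ((J4a) `satLog_eq_padicLogPointFiniteExt`, (J4b)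
`padicLogPointFiniteExt_eq_of_isEquiv`, §1, §2). [cite: SilvermanAEC2009, Thm. IV.6.4 with Prop. VII.2.2] -/
theorem exists_point_padicLogPointFiniteExt_eq_satLog
    (P : (curveK p (Kw p L w) ((integralModelInt W).map (Int.castRingHom ℤ_[p]))).toAffine.Point) :
    ∃ P' : (W.baseChange (w.1.adicCompletion L)).toAffine.Point,
      padicLogPointFiniteExt ν (W.baseChange (w.1.adicCompletion L)) p P' =
        toCompletion p L w (satLog p (Kw p L w) ((integralModelInt W).map (Int.castRingHom ℤ_[p])) P) := by
  have hC := curveK_integralModelInt_eq_baseChange (p := p) w W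
  have hequiv := valuation_isEquiv_of_compatible (p := p) w ν
  -- integrality of both models for `ν` read on `K_w`
  haveI hν₁ : (curveK p (Kw p L w) ((integralModelInt W).map (Int.castRingHom ℤ_[p]))).IsIntegral
      (ν.comap (toCompletion p L w).toRingHom).integer :=
    isIntegral_of_isEquiv hequiv _
  haveI hν₂ := isIntegral_comap_toCompletion (p := p) w ν (W.baseChange (w.1.adicCompletion L))
  -- the same point on Mathlib's model, with the same logarithm (for `ν` read on `K_w`)
  obtain ⟨P', hP'⟩ := exists_point_padicLogPointFiniteExt_eq_of_eq (ν.comap (toCompletion p L w).toRingHom) hC p P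
  refine ⟨P', ?_⟩
  rw [← padicLogPointFiniteExt_comap_toCompletion (p := p) w ν (W.baseChange (w.1.adicCompletion L)) p P', hP',
    toCompletion_apply, satLog_eq_padicLogPointFiniteExt, padicLogPointFiniteExt_apply_eq_of_isEquiv hequiv p P]

/-- **`Λ₀ʷ ⊆ log_ω(E(L_w))`**: the log-lattice of `KPort.clause_d_unit_package` at the factor `w` is contained in
the set of values of `padicLogPointFiniteExt ν (W.baseChange L_w) p` on the points of `W ⊗ L_w`, for every
compatible `ν`. [cite: SilvermanAEC2009, Thm. IV.6.4 with Prop. VII.2.2] -/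
theorem clause_d_set_subset_range_padicLogPointFiniteExt :
    {x : w.1.adicCompletion L | ∃ P ∈ (((integralModelInt W).map (Int.castRingHom ℤ_[p])).map
          (coeffHom p (Kw p L w))).nonsingularReductionSubgroup
          (Valuation.integer.integers (NormedField.valuation (K := Kw p L w))),
        toCompletion p L w (satLog p (Kw p L w) ((integralModelInt W).map (Int.castRingHom ℤ_[p])) P) = x} ⊆
      {x : w.1.adicCompletion L | ∃ P' : (W.baseChange (w.1.adicCompletion L)).toAffine.Point,
        padicLogPointFiniteExt ν (W.baseChange (w.1.adicCompletion L)) p P' = x} := by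
  rintro x ⟨P, -, rfl⟩
  exact exists_point_padicLogPointFiniteExt_eq_satLog w W ν P

/-- **Clause (e) reduction**: any property `Φ` holding for `log_ω^{ν}(P′)` at EVERY point `P′` of `W ⊗ L_w`
(the shape of (S5b-res)'s conclusion / w2-acc4's DUALINT_w: `Φ a := ∀ z, ‖Tr(exp*_ω z · a)‖ ≤ 1`) holds for
every element of kport's log-lattice `Λ₀ʷ`. [cite: SilvermanAEC2009, Thm. IV.6.4 with Prop. VII.2.2] -/
theorem forall_clause_d_set_of_forall_point (Φ : w.1.adicCompletion L → Prop)
    (hΦ : ∀ P' : (W.baseChange (w.1.adicCompletion L)).toAffine.Point,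
      Φ (padicLogPointFiniteExt ν (W.baseChange (w.1.adicCompletion L)) p P')) :
    ∀ x ∈ {x : w.1.adicCompletion L | ∃ P ∈ (((integralModelInt W).map (Int.castRingHom ℤ_[p])).map
          (coeffHom p (Kw p L w))).nonsingularReductionSubgroup
          (Valuation.integer.integers (NormedField.valuation (K := Kw p L w))),
        toCompletion p L w (satLog p (Kw p L w) ((integralModelInt W).map (Int.castRingHom ℤ_[p])) P) = x},
      Φ x := by
  intro x hx
  obtain ⟨P', hP'⟩ := clause_d_set_subset_range_padicLogPointFiniteExt w W ν hx
  rw [← hP']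
  exact hΦ P'

end Log

end Kw

end Summit.BirchSwinnertonDyer.BirchSwinnertonDyer.Theorems.KPort

end
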